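import Summits.ResolutionOfSingularities.ResolutionOfSingularities.Theses.IndSmooth

/-!
# `IndSmooth.SmoothToUniformizing`: which hypotheses are load-bearing
# (negative-side support for crux `stmt-ResolutionOfSingularities-16088`, refuter / cdisprove seat)

Crux `Summit.ResolutionOfSingularities.ResolutionOfSingularities.Theses.IndSmooth.SmoothToUniformizing`:
`∀ p prime, IndSmooth(p) → Lurel(p)`, where `IndSmooth(p)` says that over every perfect `k` of
characteristic `p` every finitely generated `R ⊆ O` (`O ⊇ k` a valuation ring of a finitely
generated field `K/k`) admits a SMOOTH CHART — a factorisation `R → T → O` of the inclusion through a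
smooth `k`-algebra `T` — and `Lurel(p)` says that every such `R` admits a MODEL — a finitely
generated `A` with `R ≤ A ⊆ O`, `Frac A = K`, regular at the centre `𝔪_O ∩ A`.

Mutations (each mutated statement is written INLINE, verbatim otherwise; nothing but theorems is
declared under `Summits/`; all sorry-free):

* `smoothToUniformizing_without_smooth_iff_lurelPerfect` — **smoothness of the charts is THE
  load-bearing hypothesis of the antecedent**: with `Algebra.Smooth k T` deleted, a "chart" always
  exists (`T := R`), so the mutated crux is EQUIVALENT to the route's open target `LurelPerfect`
  (relative local uniformization over perfect fields, open from transcendence degree 4). Any proof of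
  the crux must therefore use the smooth structure of `T` (its presentation / Jacobian data), not only
  the factorisation `R → T → O`.
* `smoothToUniformizing_without_hO_iff` — the hypothesis `k ⊆ O` (`∀ c, algebraMap k K c ∈ O`) is
  REDUNDANT on both sides (implied by `R ≤ O` for a `k`-subalgebra `R`): deleting it from antecedent
  and consequent gives an equivalent statement.
* `smoothToUniformizing_without_prime_iff` — `p.Prime` is DECORATIVE: deleting it only adds the
  characteristic-`0` instance (a field has characteristic prime or `0`; every other `p` is vacuous),
  which is Zariski's 1940 theorem (modulo the tree's named fact `Hironaka1964`, see the crux work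
  file `Cruxes/SmoothToUniformizing/Disproof.lean`, `lurelAt_zero_of_hironaka`).
* `smoothToUniformizing_pointwise_false_without_fg` — in the POINTWISE form (chart for this `R` ⇒
  model for this `R`, a natural strengthening that any per-valuation-ring proof establishes) the
  hypothesis `(⊤ : IntermediateField k K).FG` is load-bearing as bookkeeping for `Frac A = K`: witness
  `k = 𝔽_p`, `K = 𝔽_p^alg`, `O = K`, `R = k` — the chart `T = k` exists, but a finitely generated
  `A ⊆ K` with `Frac A = K` would be integral, hence finite over `𝔽_p`, hence a finite field equal to
  the infinite field `K`.

(`[PerfectField k]`: deleting it on both sides makes the crux VACUOUSLY true — the antecedent without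
perfectness is refuted by `Theorems/ValuativeSmoothing/Negative/FalseWithoutPerfectField.lean`;
deleting it in the consequent only keeps the crux implied by the summit,
`Theorems/SmoothToUniformizing/Negative/ImpliedBySummit.lean`.)
-/

set_option linter.dupNamespace false -- mandated namespace of this single-conjunct summit

namespace Summit.ResolutionOfSingularities.ResolutionOfSingularities.Theorems.SmoothToUniformizing.Negative

open Summit.ResolutionOfSingularities.ResolutionOfSingularities.Theses.IndSmooth

/-- **Smoothness of the charts is load-bearing**: the crux with `Algebra.Smooth k T` deleted from its
antecedent (inline, verbatim otherwise) is EQUIVALENT to the route's target `LurelPerfect` — without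
smoothness the chart `T := R`, `ψ := id`, `χ :=` inclusion always exists. [folklore] -/
theorem smoothToUniformizing_without_smooth_iff_lurelPerfect :
    (∀ p : ℕ, p.Prime →
      (∀ (k K : Type) [Field k] [CharP k p] [PerfectField k] [Field K] [Algebra k K],
        (⊤ : IntermediateField k K).FG → ∀ O : ValuationSubring K,
        (∀ c : k, algebraMap k K c ∈ O) → ∀ R : Subalgebra k K, R.FG →
        R.toSubring ≤ O.toSubring →
        ∃ (T : Type) (_ : CommRing T) (_ : Algebra k T),
          ∃ (ψ : R →ₐ[k] T) (χ : T →ₐ[k] K), (∀ t : T, χ t ∈ O) ∧ ∀ r : R, χ (ψ r) = (r : K)) →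
      ∀ (k K : Type) [Field k] [CharP k p] [PerfectField k] [Field K] [Algebra k K],
        (⊤ : IntermediateField k K).FG → ∀ O : ValuationSubring K,
        (∀ c : k, algebraMap k K c ∈ O) → ∀ R : Subalgebra k K, R.FG →
        R.toSubring ≤ O.toSubring →
        ∃ (A : Subalgebra k K) (h : A.toSubring ≤ O.toSubring), R ≤ A ∧ A.FG ∧
          IsFractionRing A K ∧ IsRegularLocalRing (Localization.AtPrime
            (Ideal.comap (Subring.inclusion h) (IsLocalRing.maximalIdeal O)))) ↔
    LurelPerfect := by
  constructor
  · intro h p hp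
    exact h p hp fun k K _ _ _ _ _ _ O _ R _ hRO =>
      ⟨R, inferInstance, inferInstance, AlgHom.id k R, R.val, fun t => hRO t.2, fun _ => rfl⟩
  · intro h p hp _
    exact h p hp

/-- **`k ⊆ O` is redundant**: the crux with the hypothesis `∀ c, algebraMap k K c ∈ O` deleted from
antecedent AND consequent (inline, verbatim otherwise) is equivalent to the crux, because any
`k`-subalgebra `R ≤ O` contains the image of `k`. [folklore] -/
theorem smoothToUniformizing_without_hO_iff :
    (∀ p : ℕ, p.Prime →
      (∀ (k K : Type) [Field k] [CharP k p] [PerfectField k] [Field K] [Algebra k K],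
        (⊤ : IntermediateField k K).FG → ∀ O : ValuationSubring K,
        ∀ R : Subalgebra k K, R.FG → R.toSubring ≤ O.toSubring →
        ∃ (T : Type) (_ : CommRing T) (_ : Algebra k T), Algebra.Smooth k T ∧
          ∃ (ψ : R →ₐ[k] T) (χ : T →ₐ[k] K), (∀ t : T, χ t ∈ O) ∧ ∀ r : R, χ (ψ r) = (r : K)) →
      ∀ (k K : Type) [Field k] [CharP k p] [PerfectField k] [Field K] [Algebra k K],
        (⊤ : IntermediateField k K).FG → ∀ O : ValuationSubring K,
        ∀ R : Subalgebra k K, R.FG → R.toSubring ≤ O.toSubring →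
        ∃ (A : Subalgebra k K) (h : A.toSubring ≤ O.toSubring), R ≤ A ∧ A.FG ∧
          IsFractionRing A K ∧ IsRegularLocalRing (Localization.AtPrime
            (Ideal.comap (Subring.inclusion h) (IsLocalRing.maximalIdeal O)))) ↔
    SmoothToUniformizing := by
  constructor
  · intro h p hp hind k K _ _ _ _ _ hK O _ R hR hRO
    exact h p hp (fun k K _ _ _ _ _ hK O R hR hRO =>
      hind k K hK O (fun c => hRO (R.algebraMap_mem c)) R hR hRO) k K hK O R hR hRO
  · intro h p hp hind k K _ _ _ _ _ hK O R hR hRO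
    exact h p hp (fun k K _ _ _ _ _ hK O _ R hR hRO => hind k K hK O R hR hRO) k K hK O
      (fun c => hRO (R.algebraMap_mem c)) R hR hRO

/-- **`p.Prime` is decorative**: the crux with `p.Prime` deleted (inline) is equivalent to the crux
together with its characteristic-`0` instance — for `p` neither prime nor `0` no field has
characteristic `p`, so the consequent is vacuous there. (The characteristic-`0` instance is Zariski's
local uniformization theorem, i.e. it holds modulo the tree's named fact `Hironaka1964`.)
[folklore] -/
theorem smoothToUniformizing_without_prime_iff :
    (∀ p : ℕ,
      (∀ (k K : Type) [Field k] [CharP k p] [PerfectField k] [Field K] [Algebra k K],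
        (⊤ : IntermediateField k K).FG → ∀ O : ValuationSubring K,
        (∀ c : k, algebraMap k K c ∈ O) → ∀ R : Subalgebra k K, R.FG →
        R.toSubring ≤ O.toSubring →
        ∃ (T : Type) (_ : CommRing T) (_ : Algebra k T), Algebra.Smooth k T ∧
          ∃ (ψ : R →ₐ[k] T) (χ : T →ₐ[k] K), (∀ t : T, χ t ∈ O) ∧ ∀ r : R, χ (ψ r) = (r : K)) →
      ∀ (k K : Type) [Field k] [CharP k p] [PerfectField k] [Field K] [Algebra k K],
        (⊤ : IntermediateField k K).FG → ∀ O : ValuationSubring K,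
        (∀ c : k, algebraMap k K c ∈ O) → ∀ R : Subalgebra k K, R.FG →
        R.toSubring ≤ O.toSubring →
        ∃ (A : Subalgebra k K) (h : A.toSubring ≤ O.toSubring), R ≤ A ∧ A.FG ∧
          IsFractionRing A K ∧ IsRegularLocalRing (Localization.AtPrime
            (Ideal.comap (Subring.inclusion h) (IsLocalRing.maximalIdeal O)))) ↔
    (SmoothToUniformizing ∧
      ((∀ (k K : Type) [Field k] [CharP k 0] [PerfectField k] [Field K] [Algebra k K],
        (⊤ : IntermediateField k K).FG → ∀ O : ValuationSubring K,
        (∀ c : k, algebraMap k K c ∈ O) → ∀ R : Subalgebra k K, R.FG →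
        R.toSubring ≤ O.toSubring →
        ∃ (T : Type) (_ : CommRing T) (_ : Algebra k T), Algebra.Smooth k T ∧
          ∃ (ψ : R →ₐ[k] T) (χ : T →ₐ[k] K), (∀ t : T, χ t ∈ O) ∧ ∀ r : R, χ (ψ r) = (r : K)) →
      ∀ (k K : Type) [Field k] [CharP k 0] [PerfectField k] [Field K] [Algebra k K],
        (⊤ : IntermediateField k K).FG → ∀ O : ValuationSubring K,
        (∀ c : k, algebraMap k K c ∈ O) → ∀ R : Subalgebra k K, R.FG →
        R.toSubring ≤ O.toSubring →
        ∃ (A : Subalgebra k K) (h : A.toSubring ≤ O.toSubring), R ≤ A ∧ A.FG ∧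
          IsFractionRing A K ∧ IsRegularLocalRing (Localization.AtPrime
            (Ideal.comap (Subring.inclusion h) (IsLocalRing.maximalIdeal O))))) := by
  constructor
  · intro h
    exact ⟨fun p _ => h p, h 0⟩
  · rintro ⟨h, h0⟩ p
    by_cases hp : p.Prime
    · exact h p hp
    · by_cases hp0 : p = 0
      · subst hp0
        exact h0
      · intro _ k K _ _ _ _ _
        rcases CharP.char_is_prime_or_zero k p with hc | hc
        · exact absurd hc hp
        · exact absurd hc hp0

/-- **`K/k` finitely generated is load-bearing in the pointwise form** (bookkeeping for
`Frac A = K`): the pointwise crux at `p` — a smooth chart of `R` into `O` ⇒ a model dominating `R`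
— with `(⊤ : IntermediateField k K).FG` deleted (inline) is FALSE. Witness `k = 𝔽_p`, `K = 𝔽_p^alg`,
`O = K`, `R = k`: the chart `T := k` (smooth over itself) exists, while a finitely generated `A ⊆ K`
with `Frac A = K` is integral hence finite over `𝔽_p`, hence a finite field onto which `K` — infinite
— would biject. [folklore] -/
theorem smoothToUniformizing_pointwise_false_without_fg (p : ℕ) [hp : Fact p.Prime] :
    ¬ (∀ (k K : Type) [Field k] [CharP k p] [PerfectField k] [Field K] [Algebra k K],
        ∀ O : ValuationSubring K, (∀ c : k, algebraMap k K c ∈ O) → ∀ R : Subalgebra k K, R.FG →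
        R.toSubring ≤ O.toSubring →
        (∃ (T : Type) (_ : CommRing T) (_ : Algebra k T), Algebra.Smooth k T ∧
          ∃ (ψ : R →ₐ[k] T) (χ : T →ₐ[k] K), (∀ t : T, χ t ∈ O) ∧ ∀ r : R, χ (ψ r) = (r : K)) →
        ∃ (A : Subalgebra k K) (h : A.toSubring ≤ O.toSubring), R ≤ A ∧ A.FG ∧
          IsFractionRing A K ∧ IsRegularLocalRing (Localization.AtPrime
            (Ideal.comap (Subring.inclusion h) (IsLocalRing.maximalIdeal O)))) := by
  intro H
  let k := ZMod p
  let K := AlgebraicClosure (ZMod p)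
  have hO : ∀ c : k, algebraMap k K c ∈ (⊤ : ValuationSubring K) := fun _ => trivial
  have h₀ : (⊥ : Subalgebra k K).toSubring ≤ (⊤ : ValuationSubring K).toSubring :=
    fun _ _ => Subring.mem_top _
  -- the chart `T := k` of the bottom subalgebra
  have hchart : ∃ (T : Type) (_ : CommRing T) (_ : Algebra k T), Algebra.Smooth k T ∧
      ∃ (ψ : (⊥ : Subalgebra k K) →ₐ[k] T) (χ : T →ₐ[k] K),
        (∀ t : T, χ t ∈ (⊤ : ValuationSubring K)) ∧ ∀ r : (⊥ : Subalgebra k K), χ (ψ r) = (r : K) :=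
    ⟨(⊥ : Subalgebra k K), inferInstance, inferInstance,
      Algebra.Smooth.of_equiv (Algebra.botEquiv k K).symm, AlgHom.id k _, (⊥ : Subalgebra k K).val,
      fun _ => trivial, fun _ => rfl⟩
  obtain ⟨A, h, -, hAfg, hAfr, -⟩ := H k K ⊤ hO ⊥ Subalgebra.fg_bot h₀ hchart
  -- `A` is integral and of finite type over `𝔽_p`, hence finite, hence a finite field
  haveI : Algebra.FiniteType k A := A.fg_iff_finiteType.mp hAfg
  haveI : Algebra.IsIntegral k A := ⟨fun a =>
    (isIntegral_algHom_iff A.val Subtype.val_injective).mp (Algebra.IsIntegral.isIntegral (a : K))⟩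
  haveI : Module.Finite k A := Algebra.IsIntegral.finite
  haveI : Finite A := Module.finite_of_finite k
  have hfield : IsField A := Finite.isField_of_domain A
  have hbij := hfield.localization_map_bijective (M := nonZeroDivisors A) (Rₘ := K)
    zero_notMem_nonZeroDivisors
  haveI : Finite K := Finite.of_surjective _ hbij.2
  exact not_finite K

end Summit.ResolutionOfSingularities.ResolutionOfSingularities.Theorems.SmoothToUniformizing.Negative
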